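import Literature.NumberTheory.EllipticCurves.ModularFormsGamma0FreeModule
import Literature.NumberTheory.EllipticCurves.PeriodLatticeODETransportProofs
import Literature.NumberTheory.EllipticCurves.EichlerIntegralWeierstrassProofs
import Literature.NumberTheory.EllipticCurves.EllipticUnitTheta
import Literature.NumberTheory.EllipticCurves.QExpansionCuspOrder
import Literature.NumberTheory.EllipticCurves.ModularFormsRamanujan
import Literature.NumberTheory.EllipticCurves.ModularCurveGammaIndex
import Literature.NumberTheory.ModularForms.SturmCongruenceNorm
import Mathlib.NumberTheory.ModularForms.Derivative
import HarnessLib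

/-!
# The `y`-coordinate of an `X₁(N)`-parametrisation as a quotient of `Γ₁(N)`-forms: the Rankin–Cohen bracket
# `H·ϑA − A·ϑH = ℘'_{L}(ℰ_f)·f·H²` (toward Stevens 1982 Thm 1.3.1 (b))
(route `ManinLocalTwoThree`, crux C2 `ManinOddAtFour` stmt-BirchSwinnertonDyer-22967; cell bsd-f2-manin, prover seat p1 gen 22;
`--supports stmt-BirchSwinnertonDyer-22967`; companion of `…StevensXPresentation`)

Given the `x`-presentation `X·H = A` (`X = ℘_L(ℰ_f)`, `A, H` holomorphic forms of weight `K`), the derivative `℘'_L(ℰ_f)` of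
the uniformising coordinate is presented by the first Rankin–Cohen bracket:  `H·ϑ_K A − A·ϑ_K H = (2πi)⁻¹(H·A′ − A·H′) =
℘'_L(ℰ_f)·f·H²` off the poles (`ℰ_f′ = 2πi f`; Zagier, *1-2-3* §5.2; Cremona §2.10 `dx/y = 2πi f dτ`; the tree's
`ModularParamYFunction` does this for `Γ₀(N)`-cusp forms inside `K_N`).  Function-level, for forms in `formSpace Γ k`:

* `serreDerivative_mem_formSpace`, `bracket_mem_formSpace` — `ϑ_k A ∈ M_{k+2}(Γ)`, `H·ϑA − A·ϑH ∈ M_{2k+2}(Γ)` (Mathlib's Serre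
  derivative: equivariance `serreDerivative_slash_invariant`, boundedness `isBoundedAtImInfty_serreDerivative_slash`);
* `bracket_apply` — `(H·ϑA − A·ϑH)(τ) = (2πi)⁻¹(H(τ)A′(τ) − A(τ)H′(τ))` (the `E₂`-terms cancel);
* `qExpansion_one_bracket` — for `1`-periodic cusp functions `A, H`: `qExpansion 1 (bracket) = h·θa − a·θh` (`θ = q d/dq`), hence
  RATIONAL when `a, h` are (`exists_rat_qExpansion_one_bracket`); `map_qExpansion_nat_eq_self_of_rat` — a form on `Γ₁(N)` with
  rational `q`-expansion has `σ`-fixed `q_N`-expansion;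
* `bracket_eq_derivWeierstrassP_mul` — **`(H·ϑA − A·ϑH)(τ) = ℘'_L(ℰ_f(τ))·f(τ)·H(τ)²`** whenever `ℰ_f(τ) ∉ Λ` and `X·H = A` off the poles.

No definitions, no sorry.  BSD is not proved by this file; C2 is not proved by this file.
[cite: Zagier2008, §5.1 Prop. 15 and §5.2] [cite: Stevens1982, §1.3] [cite: ShimuraIATAF1971, Thm. 7.14]
-/

set_option linter.dupNamespace false
set_option autoImplicit false

noncomputable section

open Complex Filter Topology Set Function PowerSeries
open UpperHalfPlane hiding I
open scoped Real Topology Manifold MatrixGroups PeriodPair ModularForm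
open ModularForm CongruenceSubgroup Derivative
open Literature.NumberTheory.EllipticCurves Literature.NumberTheory.EllipticCurves.ModularForms

namespace Summit.BirchSwinnertonDyer.BirchSwinnertonDyer.Theorems.ManinLocalTwoThree.StevensGalois

variable {N : ℕ}

/-! ## §1 The Serre derivative and the bracket on `formSpace Γ k` -/

/-- `M_k(Γ₁(N)) ⊆ M_k(Γ(N))`. [folklore] -/
private theorem mem_formSpace_Gamma_of_gamma1 [NeZero N] {k : ℤ} {A : ℍ → ℂ}
    (hA : A ∈ formSpace (Gamma1 N : Subgroup (GL (Fin 2) ℝ)) k) :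
    A ∈ formSpace (CongruenceSubgroup.Gamma N : Subgroup (GL (Fin 2) ℝ)) k :=
  formSpace_mono (Subgroup.map_mono (Gamma_le_Gamma1 N)) hA

/-- Translates of forms on `Γ(N)` are forms on `Γ(N)` (`Γ(N)` is normal in `SL₂(ℤ)`); copy of the tree's
`GammaTranslatesSetup.slash_mem_formSpace_Gamma`. [folklore] -/
private theorem slash_mem_formSpace_Gamma' [NeZero N] {k : ℤ} {f : ℍ → ℂ}
    (hf : f ∈ formSpace (CongruenceSubgroup.Gamma N : Subgroup (GL (Fin 2) ℝ)) k) (γ : SL(2, ℤ)) :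
    f ∣[k] γ ∈ formSpace (CongruenceSubgroup.Gamma N : Subgroup (GL (Fin 2) ℝ)) k := by
  have hf' := hf
  obtain ⟨F, hF⟩ := hf'
  rw [mem_formSpace_iff] at hf ⊢
  obtain ⟨-, hinv, hbdd⟩ := hf
  refine ⟨?_, ?_, ?_⟩
  · rw [← hF]
    exact (ModularForm.translate F (γ : GL (Fin 2) ℝ)).holo'
  · intro δ hδ
    obtain ⟨g, hg, rfl⟩ := hδ
    have hconj : γ * g * γ⁻¹ ∈ CongruenceSubgroup.Gamma N :=
      (CongruenceSubgroup.Gamma_normal N).conj_mem g hg γ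
    have h1 : f ∣[k] (γ * g * γ⁻¹) = f :=
      hinv (Matrix.SpecialLinearGroup.mapGL ℝ (γ * g * γ⁻¹)) ⟨_, hconj, rfl⟩
    show (f ∣[k] γ) ∣[k] g = f ∣[k] γ
    rw [← SlashAction.slash_mul, show γ * g = (γ * g * γ⁻¹) * γ by group, SlashAction.slash_mul, h1]
  · intro g
    have := hbdd (γ * g)
    show IsBoundedAtImInfty ((f ∣[k] γ) ∣[k] g)
    rw [← SlashAction.slash_mul]
    exact this

/-- **`ϑ_k A ∈ M_{k+2}(Γ₁(N))`** for `A ∈ M_k(Γ₁(N))` (Mathlib's Serre derivative; Zagier §5.1 Prop. 15: equivariance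
`serreDerivative_slash_invariant`; at the cusps `D(A ∣ g) → 0` for the `N`-periodic bounded `A ∣ g` and `E₂` is bounded).
[cite: Zagier2008, §5.1 Prop. 15] -/
theorem serreDerivative_mem_formSpace [NeZero N] {k : ℤ} {A : ℍ → ℂ}
    (hA : A ∈ formSpace (Gamma1 N : Subgroup (GL (Fin 2) ℝ)) k) :
    serreDerivative k A ∈ formSpace (Gamma1 N : Subgroup (GL (Fin 2) ℝ)) (k + 2) := by
  have hAΓ := mem_formSpace_Gamma_of_gamma1 hA
  obtain ⟨Amf, hAmf⟩ := hA
  have hhol : MDiff A := hAmf ▸ ModularFormClass.holo Amf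
  rw [mem_formSpace_iff]
  refine ⟨serreDerivative_mdifferentiable k hhol, ?_, fun g ↦ ?_⟩
  · rintro _ ⟨γ, hγ, rfl⟩
    change serreDerivative k A ∣[k + 2] γ = serreDerivative k A
    refine serreDerivative_slash_invariant hhol ?_
    have := SlashInvariantFormClass.slash_action_eq Amf _ ⟨γ, hγ, rfl⟩
    rw [hAmf] at this
    exact this
  · rw [← ModularForm.SL_slash, serreDerivative_slash_equivariant hhol]
    -- `A ∣ g ∈ M_k(Γ(N))`: `N`-periodic, holomorphic, bounded
    have hAg := slash_mem_formSpace_Gamma' hAΓ g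
    obtain ⟨Ag, hAg'⟩ := hAg
    have hper : Function.Periodic ((A ∣[k] g) ∘ ofComplex) (N : ℝ) := by
      rw [← hAg']
      exact SlashInvariantFormClass.periodic_comp_ofComplex Ag
        (Literature.NumberTheory.ModularForms.natCast_mem_strictPeriods_Gamma N)
    have hholg : MDiff (A ∣[k] g) := hAg' ▸ ModularFormClass.holo Ag
    have hbddg : IsBoundedAtImInfty (A ∣[k] g) := hAg' ▸ ModularFormClass.bdd_at_infty Ag
    have hD : IsBoundedAtImInfty (D (A ∣[k] g)) :=
      (isZeroAtImInfty_normalizedDeriv (Nat.cast_pos.mpr (NeZero.pos N)) hper hholg hbddg).isBoundedAtImInfty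
    have hE : IsBoundedAtImInfty (fun z ↦ (k : ℂ) * 12⁻¹ * EisensteinSeries.E2 z * (A ∣[k] g) z) := by
      have h0 := (EisensteinSeries.isBoundedAtImInfty_E2.mul hbddg).const_mul_left ((k : ℂ) * 12⁻¹)
      have hfun : (fun z ↦ (k : ℂ) * 12⁻¹ * EisensteinSeries.E2 z * (A ∣[k] g) z) =
          fun z ↦ (k : ℂ) * 12⁻¹ * (EisensteinSeries.E2 * (A ∣[k] g)) z := by
        funext z; simp only [Pi.mul_apply]; ring
      rw [hfun]
      exact h0
    have hfun : serreDerivative k (A ∣[k] g) = fun z ↦ D (A ∣[k] g) z -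
        (k : ℂ) * 12⁻¹ * EisensteinSeries.E2 z * (A ∣[k] g) z := by
      funext z; rw [serreDerivative_apply]
    rw [hfun]
    exact hD.sub hE

/-- **The bracket `H·ϑA − A·ϑH ∈ M_{2k+2}(Γ₁(N))`** for `A, H ∈ M_k(Γ₁(N))`. [cite: Zagier2008, §5.2] -/
theorem bracket_mem_formSpace [NeZero N] {k : ℤ} {A H : ℍ → ℂ}
    (hA : A ∈ formSpace (Gamma1 N : Subgroup (GL (Fin 2) ℝ)) k) (hH : H ∈ formSpace (Gamma1 N : Subgroup (GL (Fin 2) ℝ)) k) :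
    H * serreDerivative k A - A * serreDerivative k H ∈ formSpace (Gamma1 N : Subgroup (GL (Fin 2) ℝ)) (k + (k + 2)) :=
  Submodule.sub_mem _ (mul_mem_formSpace hH (serreDerivative_mem_formSpace hA))
    (mul_mem_formSpace hA (serreDerivative_mem_formSpace hH))

/-- **Pointwise formula**: `(H·ϑA − A·ϑH)(τ) = (2πi)⁻¹ (H(τ)·A′(τ) − A(τ)·H′(τ))` (the `E₂`-terms cancel).
[cite: Zagier2008, §5.2] -/
theorem bracket_apply {k : ℤ} (A H : ℍ → ℂ) (τ : ℍ) :
    (H * serreDerivative k A - A * serreDerivative k H) τ =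
      (2 * π * I)⁻¹ * (H τ * deriv (A ∘ ofComplex) τ - A τ * deriv (H ∘ ofComplex) τ) := by
  simp only [Pi.sub_apply, Pi.mul_apply, serreDerivative_apply, normalizedDerivOfComplex]
  ring

/-! ## §2 The `q`-expansion of the bracket -/

/-- **`q`-expansion of the bracket** of two `1`-periodic cusp functions: `qExpansion 1 (H·ϑA − A·ϑH) = h·θa − a·θh`
(`θ = q d/dq` = `thetaPS`; the `q`-expansion of `d/dz A` is `2πi·θa`). [cite: Zagier2008, §5.2] -/
theorem qExpansion_one_bracket {k : ℤ} {A H : ℍ → ℂ} (hA : IsCuspFunction 1 A) (hH : IsCuspFunction 1 H) :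
    qExpansion 1 (H * serreDerivative k A - A * serreDerivative k H) =
      qExpansion 1 H * thetaPS (qExpansion 1 A) - qExpansion 1 A * thetaPS (qExpansion 1 H) := by
  set a := qExpansion 1 A with ha
  set b := qExpansion 1 H with hb
  obtain ⟨hdA, edA⟩ := qexp_track_deriv hA ha.symm
  obtain ⟨hdH, edH⟩ := qexp_track_deriv hH hb.symm
  obtain ⟨h1, e1⟩ := qexp_track_mul hH hb.symm hdA edA
  obtain ⟨h2, e2⟩ := qexp_track_mul hA ha.symm hdH edH
  obtain ⟨hW, eW⟩ := qexp_track_sub h1 e1 h2 e2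
  obtain ⟨-, eB⟩ := qexp_track_smul hW eW ((2 * π * I)⁻¹ : ℂ)
  have hfun : (H * serreDerivative k A - A * serreDerivative k H : ℍ → ℂ) =
      ((2 * π * I)⁻¹ : ℂ) • (H * (fun τ : ℍ ↦ deriv (A ∘ ofComplex) τ) - A * (fun τ : ℍ ↦ deriv (H ∘ ofComplex) τ)) := by
    funext τ
    rw [bracket_apply]
    simp [smul_eq_mul]
  rw [hfun, eB, thetaPS_def, thetaPS_def]
  have hπ : (2 * π * I : ℂ) ≠ 0 :=
    mul_ne_zero (mul_ne_zero two_ne_zero (ofReal_ne_zero.mpr Real.pi_ne_zero)) I_ne_zero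
  have hC : PowerSeries.C ((2 * π * I)⁻¹ : ℂ) * PowerSeries.C (2 * π * I : ℂ) = 1 := by
    rw [← map_mul, inv_mul_cancel₀ hπ, map_one]
  linear_combination (b * PowerSeries.mk (fun n ↦ (n : ℂ) * coeff n a) -
    a * PowerSeries.mk (fun n ↦ (n : ℂ) * coeff n b)) * hC

/-- **Rationality of the bracket's `q`-expansion**: if `A, H` have rational `q`-expansions then so does `H·ϑA − A·ϑH`.
[cite: Zagier2008, §5.2] -/
theorem exists_rat_qExpansion_one_bracket {k : ℤ} {A H : ℍ → ℂ} (hA : IsCuspFunction 1 A) (hH : IsCuspFunction 1 H)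
    (hArat : ∀ n, ∃ r : ℚ, (qExpansion 1 A).coeff n = (r : ℂ)) (hHrat : ∀ n, ∃ r : ℚ, (qExpansion 1 H).coeff n = (r : ℂ))
    (n : ℕ) : ∃ r : ℚ, (qExpansion 1 (H * serreDerivative k A - A * serreDerivative k H)).coeff n = (r : ℂ) := by
  classical
  choose ra hra using hArat
  choose rh hrh using hHrat
  have haQ : qExpansion 1 A = (PowerSeries.mk ra).map (algebraMap ℚ ℂ) := by
    ext m; rw [hra m, coeff_map, coeff_mk, eq_ratCast]
  have hhQ : qExpansion 1 H = (PowerSeries.mk rh).map (algebraMap ℚ ℂ) := by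
    ext m; rw [hrh m, coeff_map, coeff_mk, eq_ratCast]
  have hθ : ∀ P : ℚ⟦X⟧, thetaPS (P.map (algebraMap ℚ ℂ)) =
      (PowerSeries.mk fun m ↦ (m : ℚ) * coeff m P).map (algebraMap ℚ ℂ) := by
    intro P; ext m
    rw [thetaPS_def, coeff_mk, coeff_map, coeff_map, coeff_mk, map_mul, map_natCast]
  rw [qExpansion_one_bracket hA hH, haQ, hhQ, hθ, hθ, ← map_mul, ← map_mul, ← map_sub, coeff_map]
  exact ⟨_, (eq_ratCast _ _)⟩

/-- A form on `Γ₁(N)` with rational `q`-expansion has a rational, hence `σ`-FIXED, `q_N`-expansion.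
[cite: ShimuraIATAF1971, §2.1 and §6.2] -/
theorem map_qExpansion_nat_eq_self_of_rat [NeZero N] {k : ℤ} (A : ModularForm (Gamma1 N) k)
    (hrat : ∀ n, ∃ r : ℚ, (qExpansion 1 ⇑A).coeff n = (r : ℂ)) (σ : ℂ →+* ℂ) :
    (qExpansion (N : ℝ) ⇑A).map σ = qExpansion (N : ℝ) ⇑A := by
  ext m
  rw [coeff_map, Literature.NumberTheory.ModularForms.coeff_qExpansion_nat_eq A (CongruenceSubgroup.strictPeriods_Gamma1 N) N m]
  split_ifs
  · obtain ⟨r, hr⟩ := hrat (m / N)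
    rw [hr, map_ratCast]
  · exact map_zero σ

/-! ## §3 The bracket of an `x`-presentation is `℘'_L(ℰ_f)·f·H²` -/

/-- **Local form of the bracket**: if `A, H` are holomorphic on `ℍ` with `℘_L(ℰ_f(τ))·H(τ) = A(τ)` whenever `ℰ_f(τ) ∉ Λ`, then at
every such `τ`, `(H·ϑA − A·ϑH)(τ) = ℘'_L(ℰ_f(τ))·f(τ)·H(τ)²` (differentiate `A = ℘_L(ℰ_f)·H`: `H·A′ − A·H′ = H²·(℘_L∘ℰ_f)′ =
H²·℘'_L(ℰ_f)·2πi f`). [cite: CremonaAlgorithms1997, §2.10] [cite: Zagier2008, §5.2] -/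
theorem bracket_eq_derivWeierstrassP_mul [NeZero N] {k : ℤ} (f : CuspForm (Gamma0 N) 2) (L : PeriodPair) {A H : ℍ → ℂ}
    (hHhol : MDifferentiable 𝓘(ℂ) 𝓘(ℂ) H)
    (hAeq : ∀ τ : ℍ, eichlerIntegral f τ ∉ L.lattice → ℘[L] (eichlerIntegral f τ) * H τ = A τ)
    {τ : ℍ} (hτ : eichlerIntegral f τ ∉ L.lattice) :
    (H * serreDerivative k A - A * serreDerivative k H) τ = ℘'[L] (eichlerIntegral f τ) * f τ * H τ ^ 2 := by
  set Ω : Set ℂ := {z : ℂ | 0 < z.im ∧ eichlerIntegral f (ofComplex z) ∉ L.lattice} with hΩ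
  have hΩo : IsOpen Ω := isOpen_setOf_eichlerIntegral_notMem_lattice f L
  have hzτ : (τ : ℂ) ∈ Ω := ⟨τ.im_pos, by simpa [ofComplex_apply] using hτ⟩
  set X : ℂ → ℂ := fun w ↦ ℘[L] (eichlerIntegral f (ofComplex w)) with hX
  set Ac : ℂ → ℂ := A ∘ ofComplex with hAc
  set Hc : ℂ → ℂ := H ∘ ofComplex with hHc
  -- `Ac = X·Hc` near `τ`
  have hev : Ac =ᶠ[𝓝 (τ : ℂ)] X * Hc := by
    filter_upwards [hΩo.mem_nhds hzτ] with w hw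
    rw [hAc, Function.comp_apply, ← hAeq (ofComplex w) hw.2]
    rfl
  have hu := hasDerivAt_eichlerIntegral f τ.im_pos
  have hXd : HasDerivAt X (℘'[L] (eichlerIntegral f (ofComplex τ)) * (2 * π * I * f (ofComplex τ))) τ :=
    HasDerivAt.comp (h₂ := ℘[L]) (h := fun w : ℂ ↦ eichlerIntegral f (ofComplex w)) (τ : ℂ)
      (L.hasDerivAt_weierstrassP_of_notMem (by simpa [ofComplex_apply] using hτ)) hu
  have hHd : HasDerivAt Hc (deriv Hc τ) τ := (UpperHalfPlane.mdifferentiableAt_iff.mp (hHhol τ)).hasDerivAt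
  have hAd : deriv Ac τ = ℘'[L] (eichlerIntegral f (ofComplex τ)) * (2 * π * I * f (ofComplex τ)) * Hc τ +
      X τ * deriv Hc τ := by
    rw [hev.deriv_eq]
    exact (hXd.mul hHd).deriv
  have hπ : (2 * π * I : ℂ) ≠ 0 :=
    mul_ne_zero (mul_ne_zero two_ne_zero (ofReal_ne_zero.mpr Real.pi_ne_zero)) I_ne_zero
  rw [bracket_apply, ← hAeq τ hτ]
  change (2 * π * I)⁻¹ * (H τ * deriv Ac τ - ℘[L] (eichlerIntegral f τ) * H τ * deriv Hc τ) = _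
  rw [hAd]
  simp only [hX, hHc, Function.comp_apply, ofComplex_apply]
  field_simp
  ring

end Summit.BirchSwinnertonDyer.BirchSwinnertonDyer.Theorems.ManinLocalTwoThree.StevensGalois

end
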